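import Mathlib
import Summits.Schanuel.Schanuel.Theorems.RootDecomp1ELevelsCells
import Summits.Schanuel.Schanuel.Theorems.RootDecomp1EEStableRung

-- `Summit.Schanuel.Schanuel.…` is the mandated layout of this single-problem summit (CONVENTIONS §1).
set_option linter.dupNamespace false

/-!
# RootDecomp1E, round 11 (lens 2 «LEVELS»), part 4: the TOP SLICE of every layer is an E-BASED CELL

Supports `stmt-Schanuel-31410` / `stmt-Schanuel-25020`.  PORT of §7 and §8 of the lens-2 gen-11 node `Levels.lean`;
imports part 2 (`RootDecomp1ELevelsCells`, hence part 1); same namespace.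
* §7 layer `4` by level: `LevelTwoDefectOneFour` (the top level a length-4 first failure can have) ⟺ the
  **E²-BASED CELL** `E2BasedDefectOneFour` («for ℚ-free algebraic `b₁, b₂`, no ℚ-free quadruple with `trdeg F_z ≥ 2`
  is exponentially algebraic over `ℚ(e^{b₁}, e^{b₂})`», `levelTwoFour_iff_e2Based`), and
  `FirstFailureLayer 4 ⟺ E2Based ∧ LowLevel` given layer 3 (`firstFailureLayer_four_iff`).
* §8 uniformly in the length: `TopLevelDefectOneAt n ⟺ EBasedCellAt n` (`topLevel_iff_eBasedCell`, `n ≥ 2`) and the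
  hypothesis-free exact decomposition `DefectOneSchanuel ⟺ ∀ n ≥ 3, EBasedCellAt n ∧ LowerLevelDefectOneAt n`
  (`defectOne_iff_cells`).
-/

noncomputable section

namespace Summit.Schanuel.Schanuel.Theorems.RootDecomp1ELevels

open Complex IntermediateField
open Summit.Schanuel.Schanuel.Theses.RootDecomp1E (DefectOneSchanuel EStableDefectOne PlainDefectOne)
open Summit.Schanuel.Schanuel.Theorems.RootDecomp1EAnchor (isAlgebraic_of_mem_adjoin
  trdeg_adjoin_le_of_isAlgebraic mem_adjoin_of_mem_span exp_isAlgebraic_of_mem_span isAlgebraic_transfer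
  trdeg_adjoin_le_nat trdeg_le_of_mem_span exists_nat_eq_of_le_natCast span_range_le
  exists_basis_span_inf isAlgebraic_of_trdeg_sandwich isAlgebraic_of_le isAlgebraic_mul isAlgebraic_add)
open Summit.Schanuel.Schanuel.Theorems.RootDecomp1EEStableRung (defectOne_of_le_two)
open Summit.Schanuel.Schanuel.Theorems.RootDecomp1EModuleGrids (subMinimal_three rat_mul_pi_eq_rat)
open Summit.Schanuel.Schanuel.Theorems.RootDecomp1EModuleType (SubMinimalDefect)
open Summit.Schanuel.Schanuel.Theorems.RootDecomp1EEngineType (LWRich PeriodRich EngineRich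
  EngineRichDefectOneAt EngineDarkDefectOneAt FirstFailureLayer defectOne_iff_typeSplit defectOne_iff_layers
  trdeg_eq_nat le_trdeg_add_one_of_subMinimal two_le_trdeg_of_subMinimal trdeg_add_two_eq_of_firstFailure
  linearIndependent_comp_castLE two_le_trdeg_of_lwRich)
open Literature.NumberTheory.Transcendental (nesterenko nesterenko' algebraicIndependent_exp_holds
  transcendental_pi_holds transcendental_exp_holds transcendental_rat_cexp_one)

/-! ## §7 LAYER 4 BY LEVEL (E-R11 (b)): the top level of a length-4 first failure is `2` (TEETH), the level-2
quadruples are EXACTLY the **E²-BASED CELL**, and `Q₃ = (e^{√2}, e, 1, √2)` is a CERTIFIED member of stmt-31410's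
class at the type-free first open length `4` whose 31410-conclusion is OPEN — and is what the cell says there. -/

/-- LEVEL-TWO quadruples: `S⁻` at ℚ-free quadruples of LW-level `≥ 2` — the TOP level a length-4 first failure can
have (`lwLevel_add_two_le_of_firstFailure`).  No sub-minimality clause: level `2` alone gives `trdeg F_z ≥ 2`. -/
def LevelTwoDefectOneFour : Prop :=
  ∀ (z : Fin 4 → ℂ), LinearIndependent ℚ z → LWLevel 2 z →
    (4 : Cardinal) ≤ Algebra.trdeg ℚ ↥(IntermediateField.adjoin ℚ (Set.range z ∪ Set.range (Complex.exp ∘ z))) + 1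

/-- LOW-LEVEL layer 4: `S⁻` at the sub-minimal ℚ-free quadruples of LW-level `≤ 1`. -/
def LowLevelDefectOneFour : Prop :=
  ∀ (z : Fin 4 → ℂ), LinearIndependent ℚ z → SubMinimalDefect 4 z → ¬ LWLevel 2 z →
    (4 : Cardinal) ≤ Algebra.trdeg ℚ ↥(IntermediateField.adjoin ℚ (Set.range z ∪ Set.range (Complex.exp ∘ z))) + 1

/-- **THE E²-BASED CELL**: for ℚ-free algebraic `b₁, b₂` and every ℚ-free quadruple `z` with `trdeg F_z ≥ 2`, NOT
all of `z₁, …, z₄, e^{z₁}, …, e^{z₄}` are algebraic over `ℚ(e^{b₁}, e^{b₂})`.  (The field `ℚ(e^{b₁}, e^{b₂})^{alg}`,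
of transcendence degree `2` by Lindemann–Weierstrass, carries no ℚ-free exponentially-closed quadruple of full
transcendence degree.)  First instance with certified hypotheses: `((1, √2); Q₃)`, §7b. -/
def E2BasedDefectOneFour : Prop :=
  ∀ (b : Fin 2 → ℂ), LinearIndependent ℚ b → (∀ j, IsAlgebraic ℚ (b j)) →
    ∀ (z : Fin 4 → ℂ), LinearIndependent ℚ z →
      (2 : Cardinal) ≤ Algebra.trdeg ℚ ↥(IntermediateField.adjoin ℚ (Set.range z ∪ Set.range (Complex.exp ∘ z))) →
      ¬ ∀ i, IsAlgebraic ↥(IntermediateField.adjoin ℚ (Set.range (Complex.exp ∘ b))) (z i) ∧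
        IsAlgebraic ↥(IntermediateField.adjoin ℚ (Set.range (Complex.exp ∘ b))) (Complex.exp (z i))

/-- `trdeg ℚ(e^{b₁}, e^{b₂}) ≤ 2`. -/
theorem trdeg_expPairField_le_two (b : Fin 2 → ℂ) :
    Algebra.trdeg ℚ ↥(adjoin ℚ (Set.range (cexp ∘ b))) ≤ ((2 : ℕ) : Cardinal) :=
  trdeg_adjoin_le_nat _ (by simpa using Cardinal.mk_range_le (f := cexp ∘ b))

/-- **LEVEL-TWO QUADRUPLES ⟹ E²-CELL**: all eight numbers algebraic over `K = ℚ(e^{b₁}, e^{b₂})` gives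
`trdeg F_z ≤ 2`; `e^{bⱼ} ∈ F_z^{alg}` by the sandwich `F_z ⊆ F_z(e^{b₁}, e^{b₂})` (both of transcendence degree `2`);
so `z` has level `2` and the level-two statement gives `trdeg F_z ≥ 3`: contradiction. -/
theorem e2Based_of_levelTwoFour (h : LevelTwoDefectOneFour) : E2BasedDefectOneFour := by
  intro b hb hbalg z hz h2 hall
  set K : IntermediateField ℚ ℂ := adjoin ℚ (Set.range (cexp ∘ b)) with hK
  have hFle : Algebra.trdeg ℚ ↥(adjoin ℚ (Set.range z ∪ Set.range (cexp ∘ z))) ≤ ((2 : ℕ) : Cardinal) := by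
    refine (trdeg_adjoin_le_of_isAlgebraic (K := K) ?_).trans (trdeg_expPairField_le_two b)
    rintro w (⟨i, rfl⟩ | ⟨i, rfl⟩)
    · exact (hall i).1
    · exact (hall i).2
  set T : Set ℂ := (Set.range z ∪ Set.range (cexp ∘ z)) ∪ Set.range (cexp ∘ b) with hT
  have hTle : Algebra.trdeg ℚ ↥(adjoin ℚ T) ≤ ((2 : ℕ) : Cardinal) := by
    refine (trdeg_adjoin_le_of_isAlgebraic (K := K) ?_).trans (trdeg_expPairField_le_two b)
    rintro w ((⟨i, rfl⟩ | ⟨i, rfl⟩) | hw)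
    · exact (hall i).1
    · exact (hall i).2
    · exact isAlgebraic_of_mem_adjoin (subset_adjoin ℚ _ hw)
  have hbF : ∀ j, IsAlgebraic ↥(adjoin ℚ (Set.range z ∪ Set.range (cexp ∘ z))) (cexp (b j)) := fun j =>
    isAlgebraic_of_trdeg_sandwich (subset_adjoin ℚ _ (Or.inr ⟨j, rfl⟩)) Set.subset_union_left hTle
      (by exact_mod_cast h2)
  have hL : LWLevel 2 z := ⟨b, hb, hbalg, hbF⟩
  have h4 := h z hz hL
  obtain ⟨s, hs, _⟩ := trdeg_eq_nat z
  rw [hs] at h4 hFle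
  have h4' : 4 ≤ s + 1 := by exact_mod_cast h4
  have h2' : s ≤ 2 := by exact_mod_cast hFle
  omega

/-- **E²-CELL ⟹ LEVEL-TWO QUADRUPLES**: at a level-2 quadruple with `trdeg F_z ≤ 2`, Lindemann–Weierstrass forces
`trdeg F_z = 2 = trdeg ℚ(e^{b₁}, e^{b₂})`, so `F_z ⊆ ℚ(e^{b₁}, e^{b₂})^{alg}` (sandwich) — excluded by the cell. -/
theorem levelTwoFour_of_e2Based (h : E2BasedDefectOneFour) : LevelTwoDefectOneFour := by
  intro z hz hL
  have h2 : (2 : Cardinal) ≤ Algebra.trdeg ℚ ↥(adjoin ℚ (Set.range z ∪ Set.range (cexp ∘ z))) := by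
    exact_mod_cast le_trdeg_of_lwLevel z hL
  obtain ⟨b, hb, hbalg, hbF⟩ := hL
  obtain ⟨s, hs, _⟩ := trdeg_eq_nat z
  rw [hs]
  by_contra hlt
  have hs2 : s ≤ 2 := by
    have : ¬ (4 : ℕ) ≤ s + 1 := fun h' => hlt (by exact_mod_cast h')
    omega
  have hai : AlgebraicIndependent ℚ fun j => cexp (b j) := algebraicIndependent_exp_holds b hbalg hb
  have hSge : ((2 : ℕ) : Cardinal) ≤ Algebra.trdeg ℚ ↥(adjoin ℚ (Set.range (cexp ∘ b))) :=
    le_trdeg_of_algebraicIndependent hai (fun j => subset_adjoin ℚ _ ⟨j, rfl⟩)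
  set T : Set ℂ := (Set.range z ∪ Set.range (cexp ∘ z)) ∪ Set.range (cexp ∘ b) with hT
  have hTle : Algebra.trdeg ℚ ↥(adjoin ℚ T) ≤ ((2 : ℕ) : Cardinal) := by
    refine (trdeg_adjoin_le_of_isAlgebraic (K := adjoin ℚ (Set.range z ∪ Set.range (cexp ∘ z))) ?_).trans
      (by rw [hs]; exact_mod_cast hs2)
    rintro w (hw | ⟨j, rfl⟩)
    · exact isAlgebraic_of_mem_adjoin (subset_adjoin ℚ _ hw)
    · exact hbF j
  have halgK : ∀ w ∈ adjoin ℚ T, IsAlgebraic ↥(adjoin ℚ (Set.range (cexp ∘ b))) w := fun w hw =>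
    isAlgebraic_of_trdeg_sandwich hw Set.subset_union_right hTle hSge
  have hFT : adjoin ℚ (Set.range z ∪ Set.range (cexp ∘ z)) ≤ adjoin ℚ T := adjoin.mono ℚ _ _ Set.subset_union_left
  exact h b hb hbalg z hz h2 fun i =>
    ⟨halgK _ (hFT (subset_adjoin ℚ _ (Or.inl ⟨i, rfl⟩))), halgK _ (hFT (subset_adjoin ℚ _ (Or.inr ⟨i, rfl⟩)))⟩

/-- **THE LEVEL-TWO QUADRUPLES ARE EXACTLY THE E²-BASED CELL.** -/
theorem levelTwoFour_iff_e2Based : LevelTwoDefectOneFour ↔ E2BasedDefectOneFour :=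
  ⟨e2Based_of_levelTwoFour, levelTwoFour_of_e2Based⟩

/-- Layer 4 from its two level parts. -/
theorem firstFailureLayer_four_of_levels (h2 : LevelTwoDefectOneFour) (h01 : LowLevelDefectOneFour) :
    FirstFailureLayer 4 := fun z hz hsub => by
  by_cases hL : LWLevel 2 z
  · exact_mod_cast h2 z hz hL
  · exact_mod_cast h01 z hz hsub hL

/-- The first-failure layer at length `4` implies the low-level defect-one statement at length `4`. -/
theorem lowLevel_of_firstFailureLayer_four (h : FirstFailureLayer 4) : LowLevelDefectOneFour :=
  fun z hz hsub _ => by exact_mod_cast h z hz hsub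

/-- The level-2 part follows from layers 3 and 4: a level-2 quadruple that is not sub-minimal contains a failing
ℚ-free TRIPLE (pairs never fail, `defectOne_of_le_two`), excluded by layer 3. -/
theorem levelTwoFour_of_layers (h3 : FirstFailureLayer 3) (h4 : FirstFailureLayer 4) : LevelTwoDefectOneFour := by
  intro z hz hL
  by_cases hsub : SubMinimalDefect 4 z
  · exact_mod_cast h4 z hz hsub
  · exfalso
    refine hsub fun m w hm hw _ => ?_
    rcases Nat.lt_or_ge m 3 with hm3 | hm3
    · exact defectOne_of_le_two m (by omega) w hw
    · obtain rfl : m = 3 := by omega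
      exact h3 w hw (subMinimal_three w)

/-- **LAYER 4 = E²-CELL ∧ LOW-LEVEL QUADRUPLES** (given layer 3, i.e. round 10/11's `n = 3` cells). -/
theorem firstFailureLayer_four_iff (h3 : FirstFailureLayer 3) :
    FirstFailureLayer 4 ↔ E2BasedDefectOneFour ∧ LowLevelDefectOneFour :=
  ⟨fun h4 => ⟨e2Based_of_levelTwoFour (levelTwoFour_of_layers h3 h4), lowLevel_of_firstFailureLayer_four h4⟩,
    fun ⟨hE, h01⟩ => firstFailureLayer_four_of_levels (levelTwoFour_of_e2Based hE) h01⟩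

/-! ## §8 THE TOP SLICE AT EVERY LENGTH: level `n − 2` of layer `n` is an E-BASED CELL, uniformly in `n`;
`S⁻ ⟺ ⋀_{n ≥ 3} (E^{n−2}-based cell of length n) ∧ (lower-level sub-minimal n-tuples)` -/

/-- TOP-LEVEL layer `n`: `S⁻` at ℚ-free `n`-tuples of LW-level `≥ n − 2` — the highest level a first failure of length
`n` can have (`lwLevel_add_two_le_of_firstFailure`).  `n = 3`: `LevelOneDefectOneThree`; `n = 4`:
`LevelTwoDefectOneFour` (`topLevel_three_iff`, `topLevel_four_iff`: definitional). -/
def TopLevelDefectOneAt (n : ℕ) : Prop :=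
  ∀ (z : Fin n → ℂ), LinearIndependent ℚ z → LWLevel (n - 2) z →
    (n : Cardinal) ≤ Algebra.trdeg ℚ ↥(IntermediateField.adjoin ℚ (Set.range z ∪ Set.range (Complex.exp ∘ z))) + 1

/-- LOWER-LEVEL layer `n`: `S⁻` at the sub-minimal ℚ-free `n`-tuples of LW-level `≤ n − 3`. -/
def LowerLevelDefectOneAt (n : ℕ) : Prop :=
  ∀ (z : Fin n → ℂ), LinearIndependent ℚ z → SubMinimalDefect n z → ¬ LWLevel (n - 2) z →
    (n : Cardinal) ≤ Algebra.trdeg ℚ ↥(IntermediateField.adjoin ℚ (Set.range z ∪ Set.range (Complex.exp ∘ z))) + 1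

/-- **THE E^{n−2}-BASED CELL OF LENGTH `n`**: for ℚ-free algebraic `b₁, …, b_{n−2}` and every ℚ-free `n`-tuple `z`
with `trdeg F_z ≥ n − 2`, NOT all of `zᵢ, e^{zᵢ}` are algebraic over `ℚ(e^{b₁}, …, e^{b_{n−2}})` — the field
`ℚ(e^{b})^{alg}` (transcendence degree `n − 2`, Lindemann–Weierstrass) carries no exponentially-closed ℚ-free `n`-tuple
of full transcendence degree.  `n = 3`: the E-based cell of §6 (up to the automatic `trdeg ≥ 1`); `n = 4`: §7. -/
def EBasedCellAt (n : ℕ) : Prop :=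
  ∀ (b : Fin (n - 2) → ℂ), LinearIndependent ℚ b → (∀ j, IsAlgebraic ℚ (b j)) →
    ∀ (z : Fin n → ℂ), LinearIndependent ℚ z →
      ((n - 2 : ℕ) : Cardinal) ≤
          Algebra.trdeg ℚ ↥(IntermediateField.adjoin ℚ (Set.range z ∪ Set.range (Complex.exp ∘ z))) →
      ¬ ∀ i, IsAlgebraic ↥(IntermediateField.adjoin ℚ (Set.range (Complex.exp ∘ b))) (z i) ∧
        IsAlgebraic ↥(IntermediateField.adjoin ℚ (Set.range (Complex.exp ∘ b))) (Complex.exp (z i))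

/-- At length `3` the top LW level is level one (by `Iff.rfl`). -/
theorem topLevel_three_iff : TopLevelDefectOneAt 3 ↔ LevelOneDefectOneThree := Iff.rfl

/-- At length `4` the top LW level is level two (by `Iff.rfl`). -/
theorem topLevel_four_iff : TopLevelDefectOneAt 4 ↔ LevelTwoDefectOneFour := Iff.rfl

/-- `trdeg ℚ(e^{b₁}, …, e^{b_k}) ≤ k`. -/
theorem trdeg_expFamilyField_le {k : ℕ} (b : Fin k → ℂ) :
    Algebra.trdeg ℚ ↥(adjoin ℚ (Set.range (cexp ∘ b))) ≤ ((k : ℕ) : Cardinal) :=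
  trdeg_adjoin_le_nat _ (by simpa using Cardinal.mk_range_le (f := cexp ∘ b))

/-- **TOP LEVEL ⟹ E-BASED CELL** (every length `n ≥ 2`; the sandwich `F_z ⊆ F_z(e^{b})`). -/
theorem eBasedCell_of_topLevel {n : ℕ} (hn : 2 ≤ n) (h : TopLevelDefectOneAt n) : EBasedCellAt n := by
  intro b hb hbalg z hz hge hall
  set K : IntermediateField ℚ ℂ := adjoin ℚ (Set.range (cexp ∘ b)) with hK
  have hFle : Algebra.trdeg ℚ ↥(adjoin ℚ (Set.range z ∪ Set.range (cexp ∘ z))) ≤ ((n - 2 : ℕ) : Cardinal) := by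
    refine (trdeg_adjoin_le_of_isAlgebraic (K := K) ?_).trans (trdeg_expFamilyField_le b)
    rintro w (⟨i, rfl⟩ | ⟨i, rfl⟩)
    · exact (hall i).1
    · exact (hall i).2
  set T : Set ℂ := (Set.range z ∪ Set.range (cexp ∘ z)) ∪ Set.range (cexp ∘ b) with hT
  have hTle : Algebra.trdeg ℚ ↥(adjoin ℚ T) ≤ ((n - 2 : ℕ) : Cardinal) := by
    refine (trdeg_adjoin_le_of_isAlgebraic (K := K) ?_).trans (trdeg_expFamilyField_le b)
    rintro w ((⟨i, rfl⟩ | ⟨i, rfl⟩) | hw)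
    · exact (hall i).1
    · exact (hall i).2
    · exact isAlgebraic_of_mem_adjoin (subset_adjoin ℚ _ hw)
  have hbF : ∀ j, IsAlgebraic ↥(adjoin ℚ (Set.range z ∪ Set.range (cexp ∘ z))) (cexp (b j)) := fun j =>
    isAlgebraic_of_trdeg_sandwich (subset_adjoin ℚ _ (Or.inr ⟨j, rfl⟩)) Set.subset_union_left hTle hge
  have hL : LWLevel (n - 2) z := ⟨b, hb, hbalg, hbF⟩
  have h4 := h z hz hL
  obtain ⟨s, hs, _⟩ := trdeg_eq_nat z
  rw [hs] at h4 hFle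
  have h4' : n ≤ s + 1 := by exact_mod_cast h4
  have h2' : s ≤ n - 2 := by exact_mod_cast hFle
  omega

/-- **E-BASED CELL ⟹ TOP LEVEL** (every length; Lindemann–Weierstrass + the sandwich `ℚ(e^{b}) ⊆ F_z(e^{b})`). -/
theorem topLevel_of_eBasedCell {n : ℕ} (h : EBasedCellAt n) : TopLevelDefectOneAt n := by
  intro z hz hL
  have hge : ((n - 2 : ℕ) : Cardinal) ≤ Algebra.trdeg ℚ ↥(adjoin ℚ (Set.range z ∪ Set.range (cexp ∘ z))) :=
    le_trdeg_of_lwLevel z hL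
  obtain ⟨b, hb, hbalg, hbF⟩ := hL
  obtain ⟨s, hs, _⟩ := trdeg_eq_nat z
  rw [hs]
  by_contra hlt
  have hs2 : s ≤ n - 2 := by
    have : ¬ n ≤ s + 1 := fun h' => hlt (by exact_mod_cast h')
    omega
  have hai : AlgebraicIndependent ℚ fun j => cexp (b j) := algebraicIndependent_exp_holds b hbalg hb
  have hSge : ((n - 2 : ℕ) : Cardinal) ≤ Algebra.trdeg ℚ ↥(adjoin ℚ (Set.range (cexp ∘ b))) :=
    le_trdeg_of_algebraicIndependent hai (fun j => subset_adjoin ℚ _ ⟨j, rfl⟩)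
  set T : Set ℂ := (Set.range z ∪ Set.range (cexp ∘ z)) ∪ Set.range (cexp ∘ b) with hT
  have hTle : Algebra.trdeg ℚ ↥(adjoin ℚ T) ≤ ((n - 2 : ℕ) : Cardinal) := by
    refine (trdeg_adjoin_le_of_isAlgebraic (K := adjoin ℚ (Set.range z ∪ Set.range (cexp ∘ z))) ?_).trans
      (by rw [hs]; exact_mod_cast hs2)
    rintro w (hw | ⟨j, rfl⟩)
    · exact isAlgebraic_of_mem_adjoin (subset_adjoin ℚ _ hw)
    · exact hbF j
  have halgK : ∀ w ∈ adjoin ℚ T, IsAlgebraic ↥(adjoin ℚ (Set.range (cexp ∘ b))) w := fun w hw =>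
    isAlgebraic_of_trdeg_sandwich hw Set.subset_union_right hTle hSge
  have hFT : adjoin ℚ (Set.range z ∪ Set.range (cexp ∘ z)) ≤ adjoin ℚ T := adjoin.mono ℚ _ _ Set.subset_union_left
  have hge' : ((n - 2 : ℕ) : Cardinal) ≤ Algebra.trdeg ℚ ↥(adjoin ℚ (Set.range z ∪ Set.range (cexp ∘ z))) := by
    rw [hs]; exact_mod_cast (show n - 2 ≤ s by exact_mod_cast (hs ▸ hge : ((n - 2 : ℕ) : Cardinal) ≤ (s : Cardinal)))
  exact h b hb hbalg z hz hge' fun i =>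
    ⟨halgK _ (hFT (subset_adjoin ℚ _ (Or.inl ⟨i, rfl⟩))), halgK _ (hFT (subset_adjoin ℚ _ (Or.inr ⟨i, rfl⟩)))⟩

/-- **THE TOP SLICE IS THE E-BASED CELL, at every length `n ≥ 2`.** -/
theorem topLevel_iff_eBasedCell {n : ℕ} (hn : 2 ≤ n) : TopLevelDefectOneAt n ↔ EBasedCellAt n :=
  ⟨eBasedCell_of_topLevel hn, topLevel_of_eBasedCell⟩

/-- Layer `n` from its top slice and its lower levels. -/
theorem firstFailureLayer_of_levels {n : ℕ} (hT : TopLevelDefectOneAt n) (hL : LowerLevelDefectOneAt n) :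
    FirstFailureLayer n := fun z hz hsub => by
  by_cases hl : LWLevel (n - 2) z
  · exact hT z hz hl
  · exact hL z hz hsub hl

/-- The first-failure layer at length `n` implies the lower-level defect-one statement at length `n`. -/
theorem lowerLevel_of_firstFailureLayer {n : ℕ} (h : FirstFailureLayer n) : LowerLevelDefectOneAt n :=
  fun z hz hsub _ => h z hz hsub

/-- **`S⁻` ⟺ ⋀_{n ≥ 3} (E^{n−2}-BASED CELL OF LENGTH n) ∧ (LOWER-LEVEL SUB-MINIMAL n-TUPLES)** — hypothesis-free
(lengths `≤ 2` never fail; the top slice of each layer is its E-based cell; the saturated layers of §2 are decided). -/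
theorem defectOne_iff_cells :
    DefectOneSchanuel ↔ ∀ n, 3 ≤ n → EBasedCellAt n ∧ LowerLevelDefectOneAt n := by
  refine ⟨fun hD n hn => ⟨eBasedCell_of_topLevel (by omega) fun z hz _ => hD n z hz, fun z hz _ _ => hD n z hz⟩,
    fun h => defectOne_iff_layers.mpr fun n => ?_⟩
  by_cases hn : 3 ≤ n
  · exact firstFailureLayer_of_levels (topLevel_of_eBasedCell (h n hn).1) (h n hn).2
  · exact fun z hz _ => defectOne_of_le_two n (by omega) z hz

end Summit.Schanuel.Schanuel.Theorems.RootDecomp1ELevels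

end
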